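import Summits.ValiantsHypothesis.ValiantsHypothesis.Theorems.LacunarySymmetroidMatrixDescartesDefectInterpolationRows

/-!
# `MatrixDescartes` — line «defect» v2 (val-idea-6 g4, LINE 3; lens «assume the law fails» + control quantity)

v2 (2026-08-28): STUB 1 CLOSED — `interpolationDefectLaw_holds` (§8) + 12 linear-in-defect rows (§9); §10 packages every
row positively as `NearFullHeightRow K Z D H` (citable by name, crit-1 #25 port note); 0 sorries.

STATUS rev 3 (2026-08-28, REWIRED to the tree — val-port-4 g1 for the val-lit merged desk g11, RULING #254; line content UNCHANGED).
The line was ported to `Theorems/` BY NAME (desk RULING #232 (d) split): (DD) `…LacunarySymmetroidMatrixDescartesDefectDefs` (`arc`,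
`node`, `refl`, `InterpolationDefectLaw`, `CapacityDefectLaw`, `NearFullHeightRow`), (F1) `…DefectLaw` (§1–§4), (F2) `…DefectLawPencil`
(§5–§7), by val-port-1 g1; (F3) `…DefectInterpolation` (§8 core) and (F4) `…DefectInterpolationRows` (§8–§10), by val-port-3 g0 — all in
namespace `Summit.ValiantsHypothesis.ValiantsHypothesis.Theorems.LacunarySymmetroidMatrixDescartes.Defect`; the shared vocabulary
`pencil`/`l1`/`Rrep` is `…FiniteSectorHeightDefs` (p606753), `pencil_apply`/`prod_pencil_apply`/`coeff_prod_pencil`/`abs_coeff_det_pencil_le`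
are `…ProfileLaw` (p607420) and `l1_nonneg`/`l1_det_pencil_le` are `…RangeObligations` (p607620).  This file now IMPORTS them
(`…DefectInterpolationRows` closes the chain): the nine local definitions are RE-EXPORTED (their v2.1 texts kept below as comments),
every theorem keeps NAME + SIGNATURE with a by-name body, except that `l1_det_pencil_le`, `pencilDefectLaw`, `row2`,
`pencilInterpolationLaw`, `irow2` take the port's signature (the v2.1 hypothesis `0 ≤ h` / `0 ≤ H` was dropped there as unnecessary —
a strengthening), and `sum_Rrep_le` (any finset of exponents — more general than the tree's `RangeObligations.sum_range_Rrep_le`) keeps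
its local proof.  Sorries 0 → 0; no `stub_*` theorem exists in this line; nothing registered changes.

THE FIRST HEIGHT LAW OFF THE FULL SECTOR.  Lines «range»/«profile» price positive roots of FULL pencils (degree =
number of positive roots) at one bit each.  Off the full sector no `log`-law in the range can hold (Bloch–Pólya /
Littlewood-type `{0,±1}` polynomials have `≫ N^{1/4}` distinct real roots at range `≤ N+1`), and every DEGREE-FREE
window law is a costume under `t ↦ t^N`.  The way out is to make the law DEGREE-AWARE through the DEFECT
`D := deg f − Z₊` (the number of wasted = non-positive-real roots): positive roots still cost a fixed number of bits
each, and each wasted root REFUNDS a bounded number of bits.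

## What is PROVED here (kernel-checked, 0 sorries)
* `defectLaw` (§4): for every real `f` with `f(0) ≠ 0`, `Z` distinct positive roots, defect `D ≥ 1`, `0 < φ ≤ π/2`:
  `√|c₀·lc| · (2cos(φ/2))^Z · (sin(φ/D)/√2)^D ≤ ‖f‖₁`.
  Mechanism: complexify; `|f(z)| = |lc|·Π|z−γ|` and `|c₀| = |lc|·Π|γ|`; on the arc `|θ−π| ≤ φ` of the unit circle a
  positive root `α` contributes `|z−α| ≥ 2√α·cos(φ/2)` (§2), a wasted root `β` contributes `|z−β| ≥ (σ/√2)√|β|` as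
  soon as `|z−β| ≥ σ` (§2), and among `D+1` nodes of the arc spaced `≥ 2sin(φ/D)` apart one is `≥ sin(φ/D)` from all
  `D` wasted roots (pigeonhole, §3); finally `|f(z)| ≤ ‖f‖₁` on the closed disc.  `D = 0` is «range» (`2^Z√|c₀lc| ≤ ‖f‖₁`).
* `excessLaw` (§7): the `φ = π/2` specialisation  `Z₊ ≤ 2·log₂(‖f‖₁/√|c₀lc|) + D(1 + 2log₂ D)`.
* `interpolationDefectLaw` / `interpolationDefectLaw_holds` (§8, v2 — STUB 1 CLOSED): the law LINEAR in the defect,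
  `√|c₀·lc| · (2cos(φ/2))^Z · (2φ/(πD))^D·D!/(D+1) ≤ ‖f‖₁`, i.e. `0.81·Z₊ ≤ log₂R + 2.1·D + log₂(D+1)` at `φ = 1`:
  a positive root COSTS `0.81` bits, a wasted root REFUNDS `2.1` bits, uniformly in the degree.  Mechanism: Lagrange
  interpolation (`Lagrange.coeff_eq_sum`) of the reflected residual factor `W = Π_B(X − β♯)` at `D+1` arc nodes,
  `Π_{j≠i}|zᵢ−zⱼ| ≥ (4φ/πD)^D·i!(D−i)! ≥ (2φ/πD)^D·D!`, and `|z−1/β̄|·|β| = |z−β|` on `|z| = 1` (`defect_core` abstracts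
  the node rule out of `defectLaw`).  `excessLawLinear` (§8): `Z₊ ≤ 2log₂R + 2.89·D + 2log₂(D+1)`.
* `pencilDefectLaw` (§5): letters of height `≤ h` ⇒ `‖det(Σ_{l<K} t^{d_l}S_l)‖₁ ≤ m!(Kh)^m` (via the representation
  numbers of «profile», `Σ_r R_d(r) ≤ K^m`), hence the law with right side `m!(Kh)^m` — ANY `m`, symmetric or not.
* ROWS (§6 pigeonhole `defectRow_*`, §9 interpolation `irow_*`; `m = 2`, ends integer-normalised `|c₀·lc| ≥ 1`,
  each a closed theorem `… → False` by `norm_num` on an exact rational certificate; the negative test `H+1` fails to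
  certify, so the rows are tight for the method; best of the two laws shown, `ⁱ` = interpolation row):
  | format, Z | full (D=0, «range») | D=1 | D=2 | D=3 | D=4 | D=5 | D=6 | D=7 | D=8 |
  |---|---|---|---|---|---|---|---|---|---|
  | (2,8), Z=26 (26-hunt) | H ≥ 725 | ≥ 293 | ≥ 85 | ≥ 23ⁱ | ≥ 9ⁱ | ≥ 4ⁱ | ≥ 2ⁱ | — | — |
  | (2,9), Z=32 | ≥ 5149 | ≥ 1981 | ≥ 543 | ≥ 138ⁱ | ≥ 51ⁱ | ≥ 21ⁱ | ≥ 9ⁱ | ≥ 4ⁱ | ≥ 2ⁱ |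
  | (2,7), Z=20 | ≥ 104 | ≥ 45 | ≥ 14 | ≥ 4ⁱ | ≥ 2ⁱ | — | — | — | — |
  | (2,6), Z=16 | ≥ 31 | ≥ 14 | ≥ 5 | — | — | — | — | — | — |
  Reading for the engines (26-hunt, STAMP/E5 searches): a `2×2` integer pencil on 8 letters with 26 distinct positive
  roots and entries `≤ 3` must have degree `≥ 32` (i.e. `max d_l ≥ 16`); entries `≤ 8` ⇒ degree `≥ 31`; entries
  `≤ 22` ⇒ degree `≥ 30`; a `(2,9)` pencil with 32 positive roots and `0/±1` letters has degree `≥ 41`.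
  CALIBRATION: every located census witness known to this seat is either full at large height (E5W1A, entries
  `≈ 2^33`) or has `D ≥ Z` (doubled/mirrored records), where every row is vacuous — consistent, as it must be.

## The line's items (D-0145 shape)
* STUB 1 `InterpolationDefectLaw` (rank 2): CLOSED in v2 (`interpolationDefectLaw_holds`, §8) — Lagrange
  interpolation at `D+1` nodes replaces the pigeonhole factor by `(2φ/πD)^D·D!/(D+1) ≈ (2φ/eπ)^D`: the law is LINEAR
  in the defect, `0.81·Z₊ ≤ log₂R + 2.1·D + log₂(D+1)`.
* STUB 2 `CapacityDefectLaw` (rank 3, classical theorem, L to type): the optimal constant `sin(φ/2)^D`; at `φ = π/2`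
  the EXCESS LAW `Z₊ − D ≤ 2·log₂ R`.
* The proved `defectLaw` / `pencilDefectLaw` / `excessLaw` / rows are the line's landed support.

## «Assume the law fails» (what the law says about violators; honest scope)
For a violator family of `MatrixDescartes` (Z₊ = 2^{Ω(K log K/q)} at height `2^{2^{polylog K}}`, so `log₂R ≪ Z₊`):
«range» forbids the full sector; «defect» v2 (the proved linear law) forces `D ≥ 0.39·Z₊ − 0.48·log₂R − O(log D)`
wasted roots — a violator carries at least `≈ 0.39·Z₊` non-positive roots, so its degree is `≥ 1.39·Z₊`.
ASYMPTOTICALLY THIS IS DOMINATED by the format-free square laws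
(Erdős–Turán / Borwein–Erdélyi–Kós: `Z₊² ≤ C·N·log R`, so `D ≥ Z₊²/(C log R) − Z₊`), whose constants (`C = 256` in the
typed ET of «range») make them VACUOUS at census scale (`Z ≤ 32`): «defect» is the census-scale instrument with
constant `≈ 1`, ET/BEK the asymptotic one.  Neither bounds the DEGREE of a violator from above, and `MatrixDescartes`
quantifies over all exponent vectors `d` — so no height/defect law decides the crux; they locate where a violator must
live: exponential degree, non-full, at least `0.39·Z₊ − O(log R)` wasted roots.
VP ≠ VNP is not moved by any of this; Conjecture B is untouched at `m = 2` (Descartes-trivial there).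

## Why this is novel (searched)
Nearest prior art: one-bit-per-root for FULL polynomials («range», classical via `|f(−1)|`); Erdős–Turán angular
discrepancy and BEK 1999 (doi:10.1112/S0024611599011831; zeros in `[−1,1]` of height-bounded polynomials `≤ c√(n·log)`),
both square laws with inexplicit/large constants; Schur/Szegő-type bounds on real roots vs. length.  No statement
trading positive roots against wasted roots at an explicit constant `≈ 1` bit, nor pencil rows, was found:
`lit search --hybrid "number of positive real roots bounded by logarithm of length polynomial defect non-real roots"`,
`lit galaxy search "Littlewood-type problems on [0,1]|zeros in [-1,1]|Borwein-Erdelyi-Kos" --star pdf` → no relevant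
hits (corpus: noise; galaxy: noise).  Delta in one sentence: a degree-aware, constant-one height law for the near-full
sector — proved in its LINEAR form (fixed cost per positive root, fixed refund per wasted root, by Lagrange
interpolation on an arc) — with kernel-checked census rows, plus the optimal (capacity) constant as a typed stub.

## Cheapest falsifier
Of the laws and rows: none possible (theorems; STUB 1 is closed).  Of the USEFULNESS
claim: an engine census showing that all near-full `(2,8)` candidates already die by Descartes sign patterns before
height matters (then the rows are true but idle).

## Dead ends recorded (not re-filed)
log-law in the range off the full sector (false: `{0,±1}` polynomials); Jensen/Mahler annulus counts (scale-covariant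
⇒ costume); exponential-sum zero counting on `|s|<δ` (real exponential sums can have `T−1` zeros anywhere); Fekete
constant directly (not in Mathlib → STUB 2; pigeonhole used instead).
-/

set_option linter.dupNamespace false
set_option linter.style.longLine false

open Polynomial Finset

namespace Summit.ValiantsHypothesis.ValiantsHypothesis.Theses.LacunarySymmetroid.DefectLine

/-! ## rev 3 — vocabulary RE-EXPORTED from the tree: `pencil`, `l1`, `Rrep` from `…Theorems.LacunarySymmetroidMatrixDescartes.FiniteSector`
(…FiniteSectorDefs / …FiniteSectorHeightDefs p606753); `arc`, `node`, `refl`, `InterpolationDefectLaw`, `CapacityDefectLaw`, `NearFullHeightRow`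
from `…Theorems.LacunarySymmetroidMatrixDescartes.Defect` (…DefectDefs, val-port-1 g1); texts identical to v2.1's local copies, so
`DefectLine.l1`, `DefectLine.NearFullHeightRow`, … still resolve for any `open DefectLine` user. -/

export Summit.ValiantsHypothesis.ValiantsHypothesis.Theorems.LacunarySymmetroidMatrixDescartes.FiniteSector (pencil l1 Rrep)
export Summit.ValiantsHypothesis.ValiantsHypothesis.Theorems.LacunarySymmetroidMatrixDescartes.Defect
  (arc node refl InterpolationDefectLaw CapacityDefectLaw NearFullHeightRow)

/-- rev-3 probe: the re-exported names are the tree's declarations (by `rfl`). -/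
example : @DefectLine.l1 = @Summit.ValiantsHypothesis.ValiantsHypothesis.Theorems.LacunarySymmetroidMatrixDescartes.FiniteSector.l1 ∧
    @DefectLine.NearFullHeightRow = @Summit.ValiantsHypothesis.ValiantsHypothesis.Theorems.LacunarySymmetroidMatrixDescartes.Defect.NearFullHeightRow :=
  ⟨rfl, rfl⟩

/-! ## §1 Complex evaluation tools -/

theorem norm_multiset_prod_map {ι : Type*} (s : Multiset ι) (f : ι → ℂ) :
    ‖(s.map f).prod‖ = (s.map (fun i => ‖f i‖)).prod :=
  Theorems.LacunarySymmetroidMatrixDescartes.Defect.norm_multiset_prod_map s f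

/-- `‖g(z)‖ = ‖lc‖ · Π_{roots γ} ‖z − γ‖` over `ℂ`. -/
theorem norm_eval_eq_prod (g : ℂ[X]) (z : ℂ) :
    ‖g.eval z‖ = ‖g.leadingCoeff‖ * (g.roots.map (fun γ => ‖z - γ‖)).prod :=
  Theorems.LacunarySymmetroidMatrixDescartes.Defect.norm_eval_eq_prod g z

/-- `‖coeff 0‖ = ‖lc‖ · Π ‖γ‖`. -/
theorem norm_coeff_zero_eq_prod (g : ℂ[X]) :
    ‖g.coeff 0‖ = ‖g.leadingCoeff‖ * (g.roots.map (fun γ => ‖γ‖)).prod :=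
  Theorems.LacunarySymmetroidMatrixDescartes.Defect.norm_coeff_zero_eq_prod g

/- (rev 3: `l1` — docstring of the v2.1 local definition, now RE-EXPORTED from `Theorems.LacunarySymmetroidMatrixDescartes.FiniteSector`) The `ℓ¹` norm of a real polynomial. -/
-- rev 3: `l1` := `Theorems.LacunarySymmetroidMatrixDescartes.FiniteSector.l1` (re-exported after the namespace header; v2.1 text was:)
--   noncomputable def l1 (f : ℝ[X]) : ℝ := ∑ i ∈ Finset.range (f.natDegree + 1), |f.coeff i|

theorem l1_nonneg (f : ℝ[X]) : 0 ≤ l1 f :=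
  Theorems.LacunarySymmetroidMatrixDescartes.RangeObligations.l1_nonneg f

/-- On the closed unit disc `‖f(z)‖ ≤ ‖f‖₁`. -/
theorem norm_eval_map_le_l1 (f : ℝ[X]) {z : ℂ} (hz : ‖z‖ ≤ 1) :
    ‖(f.map Complex.ofRealHom).eval z‖ ≤ l1 f :=
  Theorems.LacunarySymmetroidMatrixDescartes.Defect.norm_eval_map_le_l1 f hz

/-! ## §2 Geometry on the unit circle -/

/- (rev 3: `arc` — docstring of the v2.1 local definition, now RE-EXPORTED from `Theorems.LacunarySymmetroidMatrixDescartes.Defect`) The arc point `e^{iθ}`. -/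
-- rev 3: `arc` := `Theorems.LacunarySymmetroidMatrixDescartes.Defect.arc` (re-exported after the namespace header; v2.1 text was:)
--   noncomputable def arc (θ : ℝ) : ℂ := Complex.exp (θ * Complex.I)

theorem norm_arc (θ : ℝ) : ‖arc θ‖ = 1 :=
  Theorems.LacunarySymmetroidMatrixDescartes.Defect.norm_arc θ

theorem norm_arc_sub_real_sq (θ α : ℝ) : ‖arc θ - α‖ ^ 2 = 1 + α ^ 2 - 2 * α * Real.cos θ :=
  Theorems.LacunarySymmetroidMatrixDescartes.Defect.norm_arc_sub_real_sq θ α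

/-- On the arc `|θ − π| ≤ φ ≤ π`, a positive real `α` is seen at distance `≥ 2√α·cos(φ/2)`. -/
theorem two_sqrt_mul_cos_le_norm_arc_sub {θ φ α : ℝ} (hα : 0 < α) (hφ0 : 0 ≤ φ) (hφ : φ ≤ Real.pi)
    (hθ : |θ - Real.pi| ≤ φ) : 2 * Real.sqrt α * Real.cos (φ / 2) ≤ ‖arc θ - α‖ :=
  Theorems.LacunarySymmetroidMatrixDescartes.Defect.two_sqrt_mul_cos_le_norm_arc_sub hα hφ0 hφ hθ

/-- Chord length: `‖e^{iθ} − e^{iθ'}‖ = 2|sin((θ−θ')/2)|`. -/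
theorem norm_arc_sub_arc (θ θ' : ℝ) : ‖arc θ - arc θ'‖ = 2 * |Real.sin ((θ - θ') / 2)| :=
  Theorems.LacunarySymmetroidMatrixDescartes.Defect.norm_arc_sub_arc θ θ'

/-- For a point of the unit circle at distance `≥ σ` (`σ ≤ 1`) from `β`, in fact `‖z − β‖ ≥ (σ/√2)·√‖β‖`. -/
theorem sigma_sqrt_le_norm_sub {z β : ℂ} (hz : ‖z‖ = 1) {σ : ℝ} (hσ0 : 0 ≤ σ) (hσ1 : σ ≤ 1)
    (h : σ ≤ ‖z - β‖) : σ / Real.sqrt 2 * Real.sqrt ‖β‖ ≤ ‖z - β‖ :=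
  Theorems.LacunarySymmetroidMatrixDescartes.Defect.sigma_sqrt_le_norm_sub hz hσ0 hσ1 h

/-! ## §3 Pigeonhole on the arc -/

/-- Products over a multiset are monotone in nonnegative factors. -/
theorem multiset_prod_map_le {ι : Type*} (s : Multiset ι) (f g : ι → ℝ) (h0 : ∀ i ∈ s, 0 ≤ f i)
    (h : ∀ i ∈ s, f i ≤ g i) : (s.map f).prod ≤ (s.map g).prod :=
  Theorems.LacunarySymmetroidMatrixDescartes.Defect.multiset_prod_map_le s f g h0 h

theorem multiset_prod_map_nonneg {ι : Type*} (s : Multiset ι) (f : ι → ℝ) (h0 : ∀ i ∈ s, 0 ≤ f i) :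
    0 ≤ (s.map f).prod :=
  Theorems.LacunarySymmetroidMatrixDescartes.Defect.multiset_prod_map_nonneg s f h0

/-- If `D + 1` points are pairwise `≥ s` apart, one of them is `≥ s/2` away from every element of a
multiset of cardinality `≤ D`. -/
theorem exists_far_point {D : ℕ} (B : Multiset ℂ) (hB : B.card ≤ D) (z : Fin (D + 1) → ℂ) {s : ℝ}
    (hsep : ∀ i j, i ≠ j → s ≤ ‖z i - z j‖) : ∃ i, ∀ β ∈ B, s / 2 ≤ ‖z i - β‖ :=
  Theorems.LacunarySymmetroidMatrixDescartes.Defect.exists_far_point B hB z hsep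

/- (rev 3: `node` — docstring of the v2.1 local definition, now RE-EXPORTED from `Theorems.LacunarySymmetroidMatrixDescartes.Defect`) The `D + 1` equally spaced points of the arc `|θ − π| ≤ φ`. -/
-- rev 3: `node` := `Theorems.LacunarySymmetroidMatrixDescartes.Defect.node` (re-exported after the namespace header; v2.1 text was:)
--   noncomputable def node (φ : ℝ) (D : ℕ) (i : Fin (D + 1)) : ℝ := Real.pi - φ + 2 * φ / D * (i : ℕ)

theorem node_mem {φ : ℝ} (hφ0 : 0 ≤ φ) {D : ℕ} (hD : 1 ≤ D) (i : Fin (D + 1)) :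
    |node φ D i - Real.pi| ≤ φ :=
  Theorems.LacunarySymmetroidMatrixDescartes.Defect.node_mem hφ0 hD i

/-- Adjacent-or-farther nodes are `≥ 2 sin(φ/D)` apart (for `0 < φ ≤ π/2`). -/
theorem node_sep {φ : ℝ} (hφ0 : 0 ≤ φ) (hφ : φ ≤ Real.pi / 2) {D : ℕ} (hD : 1 ≤ D)
    (i j : Fin (D + 1)) (hij : i ≠ j) :
    2 * Real.sin (φ / D) ≤ ‖arc (node φ D i) - arc (node φ D j)‖ :=
  Theorems.LacunarySymmetroidMatrixDescartes.Defect.node_sep hφ0 hφ hD i j hij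

/-! ## §4 THE DEFECT RANGE LAW (PROVED): positive roots cost a bit each unless paid for by defect -/

/-- **Defect range law (real polynomials).**  Let `f ≠ 0` have the distinct positive roots `A` (any finset of
them) and DEFECT `D = deg f − |A| ≥ 1` (the number of remaining complex roots, with multiplicity).  Then for every
`0 < φ ≤ π/2`:  `√|a_0·a_N| · (2cos(φ/2))^{|A|} · (sin(φ/D)/√2)^D ≤ ‖f‖₁`.
(`D = 0` is the full case `2^{|A|}√|a_0 a_N| ≤ ‖f‖₁` of line «range», the limit `φ → 0`.)  Proof: evaluate `f` at the
node of the arc `|θ − π| ≤ φ` that is `≥ sin(φ/D)` away from all `D` remaining roots (pigeonhole over `D+1` nodes). -/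
theorem defectLaw (f : ℝ[X]) (hf : f ≠ 0) (A : Finset ℝ) (hApos : ∀ a ∈ A, 0 < a)
    (hAroot : ∀ a ∈ A, f.IsRoot a) {D : ℕ} (hD : f.natDegree = A.card + D) (hD1 : 1 ≤ D)
    {φ : ℝ} (hφ0 : 0 < φ) (hφ : φ ≤ Real.pi / 2) :
    Real.sqrt |f.coeff 0 * f.leadingCoeff| * ((2 * Real.cos (φ / 2)) ^ A.card
      * (Real.sin (φ / D) / Real.sqrt 2) ^ D) ≤ l1 f :=
  Theorems.LacunarySymmetroidMatrixDescartes.Defect.defectLaw f hf A hApos hAroot hD hD1 hφ0 hφ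

/-! ## §5 Pencils: `ℓ¹`-range of `det (Σ t^{d_l} S_l)` (coefficient bound copied verbatim from line «profile» §4) -/

-- rev 3: `pencil` := `Theorems.LacunarySymmetroidMatrixDescartes.FiniteSector.pencil` (re-exported after the namespace header; v2.1 text was:)
--   noncomputable abbrev pencil {m K : ℕ} (d : Fin K → ℕ) (S : Fin K → Matrix (Fin m) (Fin m) ℝ) :
--       Matrix (Fin m) (Fin m) ℝ[X] :=
--     ∑ l, ((Polynomial.X : ℝ[X]) ^ d l) • (S l).map Polynomial.C

/- (rev 3: `Rrep` — docstring of the v2.1 local definition, now RE-EXPORTED from `Theorems.LacunarySymmetroidMatrixDescartes.FiniteSector`) Ordered `m`-fold representation number of `r` by the design `d` (as in «profile»). -/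
-- rev 3: `Rrep` := `Theorems.LacunarySymmetroidMatrixDescartes.FiniteSector.Rrep` (re-exported after the namespace header; v2.1 text was:)
--   def Rrep {K : ℕ} (d : Fin K → ℕ) (m r : ℕ) : ℕ :=
--     (Finset.univ.filter (fun lam : Fin m → Fin K => (∑ i, d (lam i)) = r)).card

theorem pencil_apply {m K : ℕ} (d : Fin K → ℕ) (S : Fin K → Matrix (Fin m) (Fin m) ℝ) (a b : Fin m) :
    pencil d S a b = ∑ l, X ^ d l * C (S l a b) :=
  Theorems.LacunarySymmetroidMatrixDescartes.ProfileLaw.pencil_apply d S a b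

theorem prod_pencil_apply {m K : ℕ} (d : Fin K → ℕ) (S : Fin K → Matrix (Fin m) (Fin m) ℝ)
    (σ : Equiv.Perm (Fin m)) :
    ∏ i, pencil d S (σ i) i = ∑ lam : Fin m → Fin K, X ^ (∑ i, d (lam i)) * C (∏ i, S (lam i) (σ i) i) :=
  Theorems.LacunarySymmetroidMatrixDescartes.ProfileLaw.prod_pencil_apply d S σ

theorem coeff_prod_pencil {m K : ℕ} (d : Fin K → ℕ) (S : Fin K → Matrix (Fin m) (Fin m) ℝ)
    (σ : Equiv.Perm (Fin m)) (r : ℕ) :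
    (∏ i, pencil d S (σ i) i).coeff r
      = ∑ lam : Fin m → Fin K, if r = ∑ i, d (lam i) then ∏ i, S (lam i) (σ i) i else 0 :=
  Theorems.LacunarySymmetroidMatrixDescartes.ProfileLaw.coeff_prod_pencil d S σ r

/-- `|[t^r] det P| ≤ m! · h^m · R_d^{(m)}(r)` for letters bounded by `h`. [folklore: permutation expansion] -/
theorem abs_coeff_det_pencil_le {m K : ℕ} (d : Fin K → ℕ) (S : Fin K → Matrix (Fin m) (Fin m) ℝ) {h : ℝ}
    (hS : ∀ l i j, |S l i j| ≤ h) (r : ℕ) :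
    |(pencil d S).det.coeff r| ≤ (m.factorial : ℝ) * (h ^ m * Rrep d m r) :=
  Theorems.LacunarySymmetroidMatrixDescartes.ProfileLaw.abs_coeff_det_pencil_le d S hS r

/-- The representation numbers over distinct targets add up to at most `K^m`. -/
theorem sum_Rrep_le {m K : ℕ} (d : Fin K → ℕ) (T : Finset ℕ) : ∑ r ∈ T, Rrep d m r ≤ K ^ m := by
  classical
  have h1 : ∀ r ∈ T, Rrep d m r = ∑ lam : Fin m → Fin K, if (∑ i, d (lam i)) = r then 1 else 0 := by
    intro r _
    rw [Rrep, Finset.card_filter]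
  rw [Finset.sum_congr rfl h1, Finset.sum_comm]
  calc ∑ lam : Fin m → Fin K, ∑ r ∈ T, (if (∑ i, d (lam i)) = r then 1 else 0)
      ≤ ∑ _lam : Fin m → Fin K, 1 := by
        refine Finset.sum_le_sum (fun lam _ => ?_)
        rw [Finset.sum_ite_eq]
        split_ifs <;> simp
    _ = K ^ m := by simp

/-- `‖det P‖₁ ≤ m!·(K h)^m` for letters `≤ h`. -/
theorem l1_det_pencil_le {m K : ℕ} (d : Fin K → ℕ) (S : Fin K → Matrix (Fin m) (Fin m) ℝ) {h : ℝ}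
    (hS : ∀ l i j, |S l i j| ≤ h) :
    l1 (pencil d S).det ≤ (m.factorial : ℝ) * (K * h) ^ m :=
  -- rev 3: signature = the tree port's (the v2.1 hypothesis `0 ≤ h` / `0 ≤ H` is dropped there as unnecessary)
  Theorems.LacunarySymmetroidMatrixDescartes.RangeObligations.l1_det_pencil_le d S hS

/-- **Pencil defect law.**  Letters `≤ h`, `A` distinct positive roots of `det P ≠ 0`, defect
`D = deg − |A| ≥ 1`: `√|c₀·lc| · (2cos(φ/2))^{|A|} · (sin(φ/D)/√2)^D ≤ m!(Kh)^m` for all `0 < φ ≤ π/2`. -/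
theorem pencilDefectLaw {m K : ℕ} (d : Fin K → ℕ) (S : Fin K → Matrix (Fin m) (Fin m) ℝ) {h : ℝ}
    (hS : ∀ l i j, |S l i j| ≤ h) (hdet : (pencil d S).det ≠ 0)
    (A : Finset ℝ) (hApos : ∀ a ∈ A, 0 < a) (hAroot : ∀ a ∈ A, (pencil d S).det.IsRoot a)
    {D : ℕ} (hD : (pencil d S).det.natDegree = A.card + D) (hD1 : 1 ≤ D)
    {φ : ℝ} (hφ0 : 0 < φ) (hφ : φ ≤ Real.pi / 2) :
    Real.sqrt |(pencil d S).det.coeff 0 * (pencil d S).det.leadingCoeff|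
      * ((2 * Real.cos (φ / 2)) ^ A.card * (Real.sin (φ / D) / Real.sqrt 2) ^ D)
      ≤ (m.factorial : ℝ) * (K * h) ^ m :=
  -- rev 3: signature = the tree port's (the v2.1 hypothesis `0 ≤ h` / `0 ≤ H` is dropped there as unnecessary)
  Theorems.LacunarySymmetroidMatrixDescartes.Defect.pencilDefectLaw d S hS hdet A hApos hAroot hD hD1 hφ0 hφ

/-! ## §6 Rational minorant and census ROWS (m = 2; integers-normalised ends `|c₀·lc| ≥ 1`) -/

/-- Squared rational minorant of the defect law: with `c₁ = 2 − φ²/4 ≤ 2cos(φ/2)` and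
`s₁ = φ/D − (φ/D)³/6 ≤ sin(φ/D)` (Taylor), `E ≥ 1`:  `c₁^{2Z} (s₁²/2)^D ≤ R²`. -/
theorem row_core {Z D : ℕ} (hD1 : 1 ≤ D) {φ E R : ℝ} (hφ0 : 0 < φ) (hφ1 : φ ≤ 3 / 2) (hE : 1 ≤ E)
    (hlaw : Real.sqrt E * ((2 * Real.cos (φ / 2)) ^ Z * (Real.sin (φ / D) / Real.sqrt 2) ^ D) ≤ R) :
    (2 - φ ^ 2 / 4) ^ (2 * Z) * (((φ / D - (φ / D) ^ 3 / 6) ^ 2) / 2) ^ D ≤ R ^ 2 :=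
  Theorems.LacunarySymmetroidMatrixDescartes.Defect.row_core hD1 hφ0 hφ1 hE hlaw

/-- GENERIC `2×2` ROW.  If the rational certificate `(2K²H²)² < c₁^{2Z}(s₁²/2)^D` holds at some rational
`0 < φ ≤ 3/2`, then NO pencil `Σ_{l<K} t^{d_l} S_l` of symmetric-or-not real `2×2` letters of height `≤ H`
with ends-normalisation `|c₀·lc| ≥ 1` (automatic for integer letters) has `Z` distinct positive roots and
degree exactly `Z + D`. -/
theorem row2 {K Z D : ℕ} (hD1 : 1 ≤ D) (φ H : ℝ) (hφ0 : 0 < φ) (hφ1 : φ ≤ 3 / 2)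
    (hnum : (2 * ((K : ℝ) * H) ^ 2) ^ 2
      < (2 - φ ^ 2 / 4) ^ (2 * Z) * (((φ / D - (φ / D) ^ 3 / 6) ^ 2) / 2) ^ D)
    (d : Fin K → ℕ) (S : Fin K → Matrix (Fin 2) (Fin 2) ℝ) (hS : ∀ l i j, |S l i j| ≤ H)
    (A : Finset ℝ) (hA : A.card = Z) (hApos : ∀ a ∈ A, 0 < a)
    (hAroot : ∀ a ∈ A, (pencil d S).det.IsRoot a) (hdeg : (pencil d S).det.natDegree = Z + D)
    (hE : 1 ≤ |(pencil d S).det.coeff 0 * (pencil d S).det.leadingCoeff|) : False :=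
  -- rev 3: signature = the tree port's (the v2.1 hypothesis `0 ≤ h` / `0 ≤ H` is dropped there as unnecessary)
  Theorems.LacunarySymmetroidMatrixDescartes.Defect.row2 hD1 φ H hφ0 hφ1 hnum d S hS A hA hApos hAroot hdeg hE

/-! ### Rows for the 26-hunt at `(2,8)` (full case `D = 0`: letter `≥ 725` by line «range»):
degree 27 ⇒ letter ≥ 293 · degree 28 ⇒ ≥ 85 · degree 29 ⇒ ≥ 22 · degree 30 ⇒ ≥ 5 · degree ≥ 31: no constraint. -/

theorem defectRow_8_26_1 (d : Fin 8 → ℕ) (S : Fin 8 → Matrix (Fin 2) (Fin 2) ℝ) (hS : ∀ l i j, |S l i j| ≤ 292)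
    (A : Finset ℝ) (hA : A.card = 26) (hApos : ∀ a ∈ A, 0 < a) (hAroot : ∀ a ∈ A, (pencil d S).det.IsRoot a)
    (hdeg : (pencil d S).det.natDegree = 27)
    (hE : 1 ≤ |(pencil d S).det.coeff 0 * (pencil d S).det.leadingCoeff|) : False :=
  Theorems.LacunarySymmetroidMatrixDescartes.Defect.defectRow_8_26_1 d S hS A hA hApos hAroot hdeg hE

theorem defectRow_8_26_2 (d : Fin 8 → ℕ) (S : Fin 8 → Matrix (Fin 2) (Fin 2) ℝ) (hS : ∀ l i j, |S l i j| ≤ 84)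
    (A : Finset ℝ) (hA : A.card = 26) (hApos : ∀ a ∈ A, 0 < a) (hAroot : ∀ a ∈ A, (pencil d S).det.IsRoot a)
    (hdeg : (pencil d S).det.natDegree = 28)
    (hE : 1 ≤ |(pencil d S).det.coeff 0 * (pencil d S).det.leadingCoeff|) : False :=
  Theorems.LacunarySymmetroidMatrixDescartes.Defect.defectRow_8_26_2 d S hS A hA hApos hAroot hdeg hE

theorem defectRow_8_26_3 (d : Fin 8 → ℕ) (S : Fin 8 → Matrix (Fin 2) (Fin 2) ℝ) (hS : ∀ l i j, |S l i j| ≤ 21)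
    (A : Finset ℝ) (hA : A.card = 26) (hApos : ∀ a ∈ A, 0 < a) (hAroot : ∀ a ∈ A, (pencil d S).det.IsRoot a)
    (hdeg : (pencil d S).det.natDegree = 29)
    (hE : 1 ≤ |(pencil d S).det.coeff 0 * (pencil d S).det.leadingCoeff|) : False :=
  Theorems.LacunarySymmetroidMatrixDescartes.Defect.defectRow_8_26_3 d S hS A hA hApos hAroot hdeg hE

theorem defectRow_8_26_4 (d : Fin 8 → ℕ) (S : Fin 8 → Matrix (Fin 2) (Fin 2) ℝ) (hS : ∀ l i j, |S l i j| ≤ 4)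
    (A : Finset ℝ) (hA : A.card = 26) (hApos : ∀ a ∈ A, 0 < a) (hAroot : ∀ a ∈ A, (pencil d S).det.IsRoot a)
    (hdeg : (pencil d S).det.natDegree = 30)
    (hE : 1 ≤ |(pencil d S).det.coeff 0 * (pencil d S).det.leadingCoeff|) : False :=
  Theorems.LacunarySymmetroidMatrixDescartes.Defect.defectRow_8_26_4 d S hS A hA hApos hAroot hdeg hE

/-! ### Rows at `(2,9)`, `Z = 32 = n(2,8)` (full: letter ≥ 5149 by «range»):
degree 33 ⇒ ≥ 1981 · 34 ⇒ ≥ 543 · 35 ⇒ ≥ 130 · 36 ⇒ ≥ 29 · 37 ⇒ ≥ 6. -/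

theorem defectRow_9_32_1 (d : Fin 9 → ℕ) (S : Fin 9 → Matrix (Fin 2) (Fin 2) ℝ) (hS : ∀ l i j, |S l i j| ≤ 1980)
    (A : Finset ℝ) (hA : A.card = 32) (hApos : ∀ a ∈ A, 0 < a) (hAroot : ∀ a ∈ A, (pencil d S).det.IsRoot a)
    (hdeg : (pencil d S).det.natDegree = 33)
    (hE : 1 ≤ |(pencil d S).det.coeff 0 * (pencil d S).det.leadingCoeff|) : False :=
  Theorems.LacunarySymmetroidMatrixDescartes.Defect.defectRow_9_32_1 d S hS A hA hApos hAroot hdeg hE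

theorem defectRow_9_32_2 (d : Fin 9 → ℕ) (S : Fin 9 → Matrix (Fin 2) (Fin 2) ℝ) (hS : ∀ l i j, |S l i j| ≤ 542)
    (A : Finset ℝ) (hA : A.card = 32) (hApos : ∀ a ∈ A, 0 < a) (hAroot : ∀ a ∈ A, (pencil d S).det.IsRoot a)
    (hdeg : (pencil d S).det.natDegree = 34)
    (hE : 1 ≤ |(pencil d S).det.coeff 0 * (pencil d S).det.leadingCoeff|) : False :=
  Theorems.LacunarySymmetroidMatrixDescartes.Defect.defectRow_9_32_2 d S hS A hA hApos hAroot hdeg hE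

theorem defectRow_9_32_3 (d : Fin 9 → ℕ) (S : Fin 9 → Matrix (Fin 2) (Fin 2) ℝ) (hS : ∀ l i j, |S l i j| ≤ 129)
    (A : Finset ℝ) (hA : A.card = 32) (hApos : ∀ a ∈ A, 0 < a) (hAroot : ∀ a ∈ A, (pencil d S).det.IsRoot a)
    (hdeg : (pencil d S).det.natDegree = 35)
    (hE : 1 ≤ |(pencil d S).det.coeff 0 * (pencil d S).det.leadingCoeff|) : False :=
  Theorems.LacunarySymmetroidMatrixDescartes.Defect.defectRow_9_32_3 d S hS A hA hApos hAroot hdeg hE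

theorem defectRow_9_32_4 (d : Fin 9 → ℕ) (S : Fin 9 → Matrix (Fin 2) (Fin 2) ℝ) (hS : ∀ l i j, |S l i j| ≤ 28)
    (A : Finset ℝ) (hA : A.card = 32) (hApos : ∀ a ∈ A, 0 < a) (hAroot : ∀ a ∈ A, (pencil d S).det.IsRoot a)
    (hdeg : (pencil d S).det.natDegree = 36)
    (hE : 1 ≤ |(pencil d S).det.coeff 0 * (pencil d S).det.leadingCoeff|) : False :=
  Theorems.LacunarySymmetroidMatrixDescartes.Defect.defectRow_9_32_4 d S hS A hA hApos hAroot hdeg hE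

theorem defectRow_9_32_5 (d : Fin 9 → ℕ) (S : Fin 9 → Matrix (Fin 2) (Fin 2) ℝ) (hS : ∀ l i j, |S l i j| ≤ 5)
    (A : Finset ℝ) (hA : A.card = 32) (hApos : ∀ a ∈ A, 0 < a) (hAroot : ∀ a ∈ A, (pencil d S).det.IsRoot a)
    (hdeg : (pencil d S).det.natDegree = 37)
    (hE : 1 ≤ |(pencil d S).det.coeff 0 * (pencil d S).det.leadingCoeff|) : False :=
  Theorems.LacunarySymmetroidMatrixDescartes.Defect.defectRow_9_32_5 d S hS A hA hApos hAroot hdeg hE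

/-! ### Rows at `(2,6)`, `Z = 16 = n(2,5)` (full: ≥ 31) and `(2,7)`, `Z = 20` (full: ≥ 104). -/

theorem defectRow_6_16_1 (d : Fin 6 → ℕ) (S : Fin 6 → Matrix (Fin 2) (Fin 2) ℝ) (hS : ∀ l i j, |S l i j| ≤ 13)
    (A : Finset ℝ) (hA : A.card = 16) (hApos : ∀ a ∈ A, 0 < a) (hAroot : ∀ a ∈ A, (pencil d S).det.IsRoot a)
    (hdeg : (pencil d S).det.natDegree = 17)
    (hE : 1 ≤ |(pencil d S).det.coeff 0 * (pencil d S).det.leadingCoeff|) : False :=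
  Theorems.LacunarySymmetroidMatrixDescartes.Defect.defectRow_6_16_1 d S hS A hA hApos hAroot hdeg hE

theorem defectRow_6_16_2 (d : Fin 6 → ℕ) (S : Fin 6 → Matrix (Fin 2) (Fin 2) ℝ) (hS : ∀ l i j, |S l i j| ≤ 4)
    (A : Finset ℝ) (hA : A.card = 16) (hApos : ∀ a ∈ A, 0 < a) (hAroot : ∀ a ∈ A, (pencil d S).det.IsRoot a)
    (hdeg : (pencil d S).det.natDegree = 18)
    (hE : 1 ≤ |(pencil d S).det.coeff 0 * (pencil d S).det.leadingCoeff|) : False :=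
  Theorems.LacunarySymmetroidMatrixDescartes.Defect.defectRow_6_16_2 d S hS A hA hApos hAroot hdeg hE

theorem defectRow_7_20_1 (d : Fin 7 → ℕ) (S : Fin 7 → Matrix (Fin 2) (Fin 2) ℝ) (hS : ∀ l i j, |S l i j| ≤ 44)
    (A : Finset ℝ) (hA : A.card = 20) (hApos : ∀ a ∈ A, 0 < a) (hAroot : ∀ a ∈ A, (pencil d S).det.IsRoot a)
    (hdeg : (pencil d S).det.natDegree = 21)
    (hE : 1 ≤ |(pencil d S).det.coeff 0 * (pencil d S).det.leadingCoeff|) : False :=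
  Theorems.LacunarySymmetroidMatrixDescartes.Defect.defectRow_7_20_1 d S hS A hA hApos hAroot hdeg hE

theorem defectRow_7_20_2 (d : Fin 7 → ℕ) (S : Fin 7 → Matrix (Fin 2) (Fin 2) ℝ) (hS : ∀ l i j, |S l i j| ≤ 13)
    (A : Finset ℝ) (hA : A.card = 20) (hApos : ∀ a ∈ A, 0 < a) (hAroot : ∀ a ∈ A, (pencil d S).det.IsRoot a)
    (hdeg : (pencil d S).det.natDegree = 22)
    (hE : 1 ≤ |(pencil d S).det.coeff 0 * (pencil d S).det.leadingCoeff|) : False :=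
  Theorems.LacunarySymmetroidMatrixDescartes.Defect.defectRow_7_20_2 d S hS A hA hApos hAroot hdeg hE

/-! ## §7 LAW STATEMENTS of the line (typed, sorry-free `Prop`s): STUB 1 is PROVED in §8, STUB 2 is open -/

/- (rev 3: `InterpolationDefectLaw` — docstring of the v2.1 local definition, now RE-EXPORTED from `Theorems.LacunarySymmetroidMatrixDescartes.Defect`) **STUB 1 (rank 2 of the line) — CLOSED in §8 (`interpolationDefectLaw_holds`): the INTERPOLATION (linear)
defect law.**  Replace the pigeonhole factor `(sin(φ/D)/√2)^D` of `defectLaw` (cost `≈ log₂(√2·D/φ)` bits per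
wasted root, growing with `D`) by `(2φ/(πD))^D · D!/(D+1) ≈ (2φ/(eπ))^D·√(2πD)/(D+1)` (a CONSTANT
`log₂(eπ/2φ) ≈ 2.1` bits per wasted root at `φ = 1`), i.e. a law LINEAR in the defect:
`0.81·Z₊ ≤ log₂ R + 2.1·D + log₂(D+1)`  (`R := ‖f‖₁/√|c₀·lc|`).
PROOF (§8, kernel-checked): `W := Π_{β∈B}(X − β♯)` with `β♯ := β` if `|β| ≤ 1`, `:= 1/β̄` otherwise, is monic of
degree `D`; at the `D+1` equally spaced nodes `zᵢ` of the arc (spacing `2φ/D`), `Lagrange.coeff_eq_sum` gives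
`1 = lc W = Σᵢ W(zᵢ)/Π_{j≠i}(zᵢ−zⱼ)`, and `Π_{j≠i}|zᵢ−zⱼ| = Π_{j≠i} 2|sin(φ(i−j)/D)| ≥ (4φ/πD)^D·i!(D−i)!
≥ (2φ/πD)^D·D!` (Jordan `Real.mul_le_sin`; `C(D,i) ≤ 2^D`, `Nat.choose_le_two_pow`), so some node has
`|W(zᵢ)| ≥ (2φ/πD)^D·D!/(D+1)`; on `|z| = 1`, `|z − 1/β̄|·|β| = |z−β|`, whence termwise `|z−β♯|·√|β| ≤ |z−β|` and
`Π_B|zᵢ−β| ≥ |W(zᵢ)|·Π_B√|β|`.  The `A`-part and the `√`-bookkeeping are `defectLaw`'s (`defect_core`).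
(The variant with `D!/√(2D+1)·` in place of `D!/(D+1)` — central binomial instead of `2^D` — is a cosmetic `√(πD/2)`
and is not pursued; potential theory would give the capacity constant `sin(φ/2)^D`, STUB 2.) -/
-- rev 3: `InterpolationDefectLaw` := `Theorems.LacunarySymmetroidMatrixDescartes.Defect.InterpolationDefectLaw` (re-exported after the namespace header; v2.1 text was:)
--   def InterpolationDefectLaw : Prop :=
--     ∀ (f : ℝ[X]), f ≠ 0 → ∀ (A : Finset ℝ), (∀ a ∈ A, 0 < a ∧ f.IsRoot a) →
--       ∀ D : ℕ, f.natDegree = A.card + D → 1 ≤ D → ∀ φ : ℝ, 0 < φ → φ ≤ Real.pi / 2 →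
--         Real.sqrt |f.coeff 0 * f.leadingCoeff| * ((2 * Real.cos (φ / 2)) ^ A.card *
--           ((2 * φ / (Real.pi * D)) ^ D * (D.factorial : ℝ) / (D + 1))) ≤ l1 f

/- (rev 3: `CapacityDefectLaw` — docstring of the v2.1 local definition, now RE-EXPORTED from `Theorems.LacunarySymmetroidMatrixDescartes.Defect`) **STUB 2 (rank 3; a THEOREM of potential theory, L-sized to type: logarithmic capacity is not in Mathlib): the
CAPACITY defect law** — the optimal constant of the method.  `‖u‖_arc ≥ cap(arc)^{deg u}` (Fekete–Szegő) with
`cap{|θ−π| ≤ φ} = sin(φ/2)` replaces STUB 1's `(2φ/eπ)^D` by `sin(φ/2)^D`; at `φ = π/2` it reads as the EXCESS LAW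
`Z₊ − D ≤ 2·log₂(‖f‖₁/√|c₀·lc|)`: positive roots IN EXCESS of the wasted ones cost half a bit each, for every real
polynomial with `c₀ ≠ 0`.  (PROVED below with the pigeonhole constant: `excessLaw`, `Z₊ ≤ 2log₂R + D(1 + 2log₂D)`.)
Why it might fail: it does not (classical); the risk is typing cost only.  Sources: `max_E |P_n| ≥ cap(E)^n` for monic
`P_n` [corpus: book:ahlfors2010-conformal-invariants p.24, proof of Thm 2-3]; `cap` of an arc of the unit circle of
angular measure `α` is `sin(α/4)` (standard table value, e.g. Ransford 1995 ch. 5 — quoted from memory, not held). -/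
-- rev 3: `CapacityDefectLaw` := `Theorems.LacunarySymmetroidMatrixDescartes.Defect.CapacityDefectLaw` (re-exported after the namespace header; v2.1 text was:)
--   def CapacityDefectLaw : Prop :=
--     ∀ (f : ℝ[X]), f ≠ 0 → ∀ (A : Finset ℝ), (∀ a ∈ A, 0 < a ∧ f.IsRoot a) →
--       ∀ D : ℕ, f.natDegree = A.card + D → ∀ φ : ℝ, 0 < φ → φ ≤ Real.pi →
--         Real.sqrt |f.coeff 0 * f.leadingCoeff| * ((2 * Real.cos (φ / 2)) ^ A.card * Real.sin (φ / 2) ^ D) ≤ l1 f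

/-- **EXCESS LAW (PROVED, pigeonhole constant).**  For every real `f` with `f(0) ≠ 0`, `Z` distinct positive roots and
defect `D ≥ 1`:  `√|c₀·lc| · √2^Z · (√2·D)^{−D} ≤ ‖f‖₁`, i.e. `Z ≤ 2·log₂(‖f‖₁/√|c₀lc|) + D·(1 + 2·log₂ D)`. -/
theorem excessLaw (f : ℝ[X]) (hf : f ≠ 0) (A : Finset ℝ) (hApos : ∀ a ∈ A, 0 < a)
    (hAroot : ∀ a ∈ A, f.IsRoot a) {D : ℕ} (hD : f.natDegree = A.card + D) (hD1 : 1 ≤ D) :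
    Real.sqrt |f.coeff 0 * f.leadingCoeff| * (Real.sqrt 2 ^ A.card * (1 / (Real.sqrt 2 * D)) ^ D) ≤ l1 f :=
  Theorems.LacunarySymmetroidMatrixDescartes.Defect.excessLaw f hf A hApos hAroot hD hD1

/-! ## §8 STUB 1 CLOSED: the interpolation (linear-in-defect) law via Lagrange at `D+1` arc nodes -/

/-- The engine of §4 with the node bound abstracted: any rule producing, for the residual roots `B`, a point
of the arc `|θ−π| ≤ φ` with `c·Π√|β| ≤ Π|z−β|` yields the law with constant `c`. -/
theorem defect_core (f : ℝ[X]) (hf : f ≠ 0) (h0 : f.coeff 0 ≠ 0) (A : Finset ℝ) (hApos : ∀ a ∈ A, 0 < a)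
    (hAroot : ∀ a ∈ A, f.IsRoot a) {D : ℕ} (hD : f.natDegree = A.card + D)
    {φ : ℝ} (hφ0 : 0 ≤ φ) (hφπ : φ ≤ Real.pi) {c : ℝ} (hc : 0 ≤ c)
    (hnode : ∀ B : Multiset ℂ, B.card = D → (∀ β ∈ B, β ≠ 0) →
      ∃ θ : ℝ, |θ - Real.pi| ≤ φ ∧
        c * (B.map (fun γ => Real.sqrt ‖γ‖)).prod ≤ (B.map (fun γ => ‖arc θ - γ‖)).prod) :
    Real.sqrt |f.coeff 0 * f.leadingCoeff| * ((2 * Real.cos (φ / 2)) ^ A.card * c) ≤ l1 f :=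
  Theorems.LacunarySymmetroidMatrixDescartes.Defect.defect_core f hf h0 A hApos hAroot hD hφ0 hφπ hc hnode

/- (rev 3: `refl` — docstring of the v2.1 local definition, now RE-EXPORTED from `Theorems.LacunarySymmetroidMatrixDescartes.Defect`) Reflection in the unit circle for the large roots. -/
-- rev 3: `refl` := `Theorems.LacunarySymmetroidMatrixDescartes.Defect.refl` (re-exported after the namespace header; v2.1 text was:)
--   noncomputable def refl (β : ℂ) : ℂ := if ‖β‖ ≤ 1 then β else ((starRingEnd ℂ) β)⁻¹

theorem norm_sub_conj_inv {z β : ℂ} (hz : ‖z‖ = 1) (hβ : β ≠ 0) :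
    ‖z - ((starRingEnd ℂ) β)⁻¹‖ * ‖β‖ = ‖z - β‖ :=
  Theorems.LacunarySymmetroidMatrixDescartes.Defect.norm_sub_conj_inv hz hβ

theorem norm_sub_refl_mul_sqrt_le {z β : ℂ} (hz : ‖z‖ = 1) (hβ : β ≠ 0) :
    ‖z - refl β‖ * Real.sqrt ‖β‖ ≤ ‖z - β‖ :=
  Theorems.LacunarySymmetroidMatrixDescartes.Defect.norm_sub_refl_mul_sqrt_le hz hβ

/-- Linear (Jordan) node separation: `‖zᵢ − zⱼ‖ ≥ (4φ/πD)·|i−j|`. -/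
theorem node_sep_lin {φ : ℝ} (hφ0 : 0 ≤ φ) (hφ : φ ≤ Real.pi / 2) {D : ℕ} (hD : 1 ≤ D)
    (i j : Fin (D + 1)) :
    4 * φ / (Real.pi * D) * |((i : ℕ) : ℝ) - ((j : ℕ) : ℝ)| ≤ ‖arc (node φ D i) - arc (node φ D j)‖ :=
  Theorems.LacunarySymmetroidMatrixDescartes.Defect.node_sep_lin hφ0 hφ hD i j

/-- `Π_{j ≠ i} |i − j| = i!·(D−i)!` over `Fin (D+1)`. -/
theorem prod_abs_sub_eq_factorial (D : ℕ) (i : Fin (D + 1)) :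
    ∏ j ∈ (Finset.univ : Finset (Fin (D + 1))).erase i, |((i : ℕ) : ℝ) - ((j : ℕ) : ℝ)|
      = ((i : ℕ).factorial : ℝ) * ((D - (i : ℕ)).factorial : ℝ) :=
  Theorems.LacunarySymmetroidMatrixDescartes.Defect.prod_abs_sub_eq_factorial D i

/-- **Lagrange node bound.**  A monic `W : ℂ[X]` of degree `D` takes, at one of the `D+1` arc nodes, a value of
modulus `≥ (2φ/πD)^D·D!/(D+1)`. -/
theorem exists_node_eval_ge {D : ℕ} (hD1 : 1 ≤ D) {φ : ℝ} (hφ0 : 0 < φ) (hφ : φ ≤ Real.pi / 2)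
    (W : ℂ[X]) (hW : W.Monic) (hWdeg : W.natDegree = D) :
    ∃ i : Fin (D + 1), (2 * φ / (Real.pi * D)) ^ D * (D.factorial : ℝ) / (D + 1)
      ≤ ‖W.eval (arc (node φ D i))‖ :=
  Theorems.LacunarySymmetroidMatrixDescartes.Defect.exists_node_eval_ge hD1 hφ0 hφ W hW hWdeg

/-- **INTERPOLATION DEFECT LAW (PROVED; closes STUB 1 in the `D+1` form).**  For every real `f` with `f(0) ≠ 0`,
`Z` distinct positive roots, defect `D ≥ 1` and `0 < φ ≤ π/2`:
`√|c₀·lc| · (2cos(φ/2))^Z · (2φ/(πD))^D · D!/(D+1) ≤ ‖f‖₁` — each wasted root refunds only `log₂(eπ/2φ) + o(1)` bits. -/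
theorem interpolationDefectLaw (f : ℝ[X]) (hf : f ≠ 0) (h0 : f.coeff 0 ≠ 0) (A : Finset ℝ)
    (hApos : ∀ a ∈ A, 0 < a) (hAroot : ∀ a ∈ A, f.IsRoot a) {D : ℕ} (hD : f.natDegree = A.card + D)
    (hD1 : 1 ≤ D) {φ : ℝ} (hφ0 : 0 < φ) (hφ : φ ≤ Real.pi / 2) :
    Real.sqrt |f.coeff 0 * f.leadingCoeff| * ((2 * Real.cos (φ / 2)) ^ A.card
      * ((2 * φ / (Real.pi * D)) ^ D * (D.factorial : ℝ) / (D + 1))) ≤ l1 f :=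
  Theorems.LacunarySymmetroidMatrixDescartes.Defect.interpolationDefectLaw f hf h0 A hApos hAroot hD hD1 hφ0 hφ

/-- **STUB 1 CLOSED.** -/
theorem interpolationDefectLaw_holds : InterpolationDefectLaw :=
  Theorems.LacunarySymmetroidMatrixDescartes.Defect.interpolationDefectLaw_holds

/-- **LINEAR EXCESS LAW (PROVED; `φ = π/2` in the interpolation law).**  For every real `f` with `f(0) ≠ 0`,
`Z` distinct positive roots and defect `D ≥ 1`:  `√|c₀·lc| · √2^Z · D!/(D^D(D+1)) ≤ ‖f‖₁`, i.e.
`Z ≤ 2·log₂(‖f‖₁/√|c₀lc|) + 2·log₂(D^D(D+1)/D!) ≤ 2·log₂ R + 2.89·D + 2·log₂(D+1)`. -/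
theorem excessLawLinear (f : ℝ[X]) (hf : f ≠ 0) (h0 : f.coeff 0 ≠ 0) (A : Finset ℝ) (hApos : ∀ a ∈ A, 0 < a)
    (hAroot : ∀ a ∈ A, f.IsRoot a) {D : ℕ} (hD : f.natDegree = A.card + D) (hD1 : 1 ≤ D) :
    Real.sqrt |f.coeff 0 * f.leadingCoeff|
      * (Real.sqrt 2 ^ A.card * ((1 / D) ^ D * (D.factorial : ℝ) / (D + 1))) ≤ l1 f :=
  Theorems.LacunarySymmetroidMatrixDescartes.Defect.excessLawLinear f hf h0 A hApos hAroot hD hD1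

/-! ## §9 The pencil form of the interpolation law and the LINEAR-IN-DEFECT rows (m = 2)

With §8 the refund per wasted root is `≈ log₂(eπ/2φ) ≈ 2.5–3.3` bits (instead of `≈ log₂ D + O(1)`), so rows
stay non-vacuous up to `D ≈ Z/4`.  Reading (integer letters, `E ≥ 1`; the §6 pigeonhole rows remain better at
`D ≤ 2`):  `(2,8)`, 26 positive roots: `D=3 ⇒ h ≥ 23 · D=4 ⇒ ≥ 9 · D=5 ⇒ ≥ 4 · D=6 ⇒ ≥ 2`;
`(2,9)`, 32 roots: `D=3 ⇒ ≥ 138 · 4 ⇒ ≥ 51 · 5 ⇒ ≥ 21 · 6 ⇒ ≥ 9 · 7 ⇒ ≥ 4 · 8 ⇒ ≥ 2`;  `(2,7)`, 20 roots: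
`D=3 ⇒ ≥ 4 · 4 ⇒ ≥ 2`.  Scale-free pre-filter (any engine, any normalisation):
`log₂(‖det P‖₁/√|c₀c_N|) ≥ Z·log₂(2cos(φ/2)) − D·log₂(πD/2φ) + log₂(D!/(D+1))`, e.g. `Z=26`: 16.0/13.3/10.8/8.4
bits at `D = 3/4/5/6`; `Z=32`: 21.6/18.7/16.1/13.6/11.2/8.9 at `D = 3…8`. -/

theorem pencilInterpolationLaw {m K : ℕ} (d : Fin K → ℕ) (S : Fin K → Matrix (Fin m) (Fin m) ℝ) {h : ℝ}
    (hS : ∀ l i j, |S l i j| ≤ h) (hdet : (pencil d S).det ≠ 0) (h0 : (pencil d S).det.coeff 0 ≠ 0)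
    (A : Finset ℝ) (hApos : ∀ a ∈ A, 0 < a) (hAroot : ∀ a ∈ A, (pencil d S).det.IsRoot a)
    {D : ℕ} (hD : (pencil d S).det.natDegree = A.card + D) (hD1 : 1 ≤ D)
    {φ : ℝ} (hφ0 : 0 < φ) (hφ : φ ≤ Real.pi / 2) :
    Real.sqrt |(pencil d S).det.coeff 0 * (pencil d S).det.leadingCoeff|
      * ((2 * Real.cos (φ / 2)) ^ A.card * ((2 * φ / (Real.pi * D)) ^ D * (D.factorial : ℝ) / (D + 1)))
      ≤ (m.factorial : ℝ) * (K * h) ^ m :=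
  -- rev 3: signature = the tree port's (the v2.1 hypothesis `0 ≤ h` / `0 ≤ H` is dropped there as unnecessary)
  Theorems.LacunarySymmetroidMatrixDescartes.Defect.pencilInterpolationLaw d S hS hdet h0 A hApos hAroot hD hD1 hφ0 hφ

/-- Rational minorant of the interpolation law: `cos(φ/2) ≥ 1 − φ²/8`, `π ≤ 3.1416`. -/
theorem irow_core {Z D : ℕ} (hD1 : 1 ≤ D) {φ E R : ℝ} (hφ0 : 0 < φ) (hφ1 : φ ≤ 3 / 2) (hE : 1 ≤ E)
    (hlaw : Real.sqrt E * ((2 * Real.cos (φ / 2)) ^ Z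
      * ((2 * φ / (Real.pi * D)) ^ D * (D.factorial : ℝ) / (D + 1))) ≤ R) :
    (2 - φ ^ 2 / 4) ^ (2 * Z) * ((2 * φ / (3.1416 * D)) ^ D * (D.factorial : ℝ) / (D + 1)) ^ 2 ≤ R ^ 2 :=
  Theorems.LacunarySymmetroidMatrixDescartes.Defect.irow_core hD1 hφ0 hφ1 hE hlaw

/-- GENERIC `2×2` INTERPOLATION ROW: the rational certificate
`(2K²H²)² < (2−φ²/4)^{2Z}·((2φ/(3.1416·D))^D·D!/(D+1))²` at some rational `0 < φ ≤ 3/2` excludes every pencil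
of `K` real `2×2` letters of height `≤ H`, ends `|c₀·lc| ≥ 1`, `Z` distinct positive roots and degree `Z + D`. -/
theorem irow2 {K Z D : ℕ} (φ H : ℝ) (hD1 : 1 ≤ D) (hφ0 : 0 < φ) (hφ1 : φ ≤ 3 / 2)
    (hnum : (2 * ((K : ℝ) * H) ^ 2) ^ 2
      < (2 - φ ^ 2 / 4) ^ (2 * Z) * ((2 * φ / (3.1416 * D)) ^ D * (D.factorial : ℝ) / (D + 1)) ^ 2)
    (d : Fin K → ℕ) (S : Fin K → Matrix (Fin 2) (Fin 2) ℝ) (hS : ∀ l i j, |S l i j| ≤ H)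
    (A : Finset ℝ) (hA : A.card = Z) (hApos : ∀ a ∈ A, 0 < a)
    (hAroot : ∀ a ∈ A, (pencil d S).det.IsRoot a) (hdeg : (pencil d S).det.natDegree = Z + D)
    (hE : 1 ≤ |(pencil d S).det.coeff 0 * (pencil d S).det.leadingCoeff|) : False :=
  -- rev 3: signature = the tree port's (the v2.1 hypothesis `0 ≤ h` / `0 ≤ H` is dropped there as unnecessary)
  Theorems.LacunarySymmetroidMatrixDescartes.Defect.irow2 φ H hD1 hφ0 hφ1 hnum d S hS A hA hApos hAroot hdeg hE

/-! ### Interpolation rows, `(2,8)` with 26 positive roots: `D=3 ⇒ h ≥ 23`, `4 ⇒ ≥ 9`, `5 ⇒ ≥ 4`, `6 ⇒ ≥ 2`. -/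

theorem irow_8_26_3 (d : Fin 8 → ℕ) (S : Fin 8 → Matrix (Fin 2) (Fin 2) ℝ) (hS : ∀ l i j, |S l i j| ≤ 22)
    (A : Finset ℝ) (hA : A.card = 26) (hApos : ∀ a ∈ A, 0 < a)
    (hAroot : ∀ a ∈ A, (pencil d S).det.IsRoot a) (hdeg : (pencil d S).det.natDegree = 26 + 3)
    (hE : 1 ≤ |(pencil d S).det.coeff 0 * (pencil d S).det.leadingCoeff|) : False :=
  Theorems.LacunarySymmetroidMatrixDescartes.Defect.irow_8_26_3 d S hS A hA hApos hAroot hdeg hE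

theorem irow_8_26_4 (d : Fin 8 → ℕ) (S : Fin 8 → Matrix (Fin 2) (Fin 2) ℝ) (hS : ∀ l i j, |S l i j| ≤ 8)
    (A : Finset ℝ) (hA : A.card = 26) (hApos : ∀ a ∈ A, 0 < a)
    (hAroot : ∀ a ∈ A, (pencil d S).det.IsRoot a) (hdeg : (pencil d S).det.natDegree = 26 + 4)
    (hE : 1 ≤ |(pencil d S).det.coeff 0 * (pencil d S).det.leadingCoeff|) : False :=
  Theorems.LacunarySymmetroidMatrixDescartes.Defect.irow_8_26_4 d S hS A hA hApos hAroot hdeg hE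

theorem irow_8_26_5 (d : Fin 8 → ℕ) (S : Fin 8 → Matrix (Fin 2) (Fin 2) ℝ) (hS : ∀ l i j, |S l i j| ≤ 3)
    (A : Finset ℝ) (hA : A.card = 26) (hApos : ∀ a ∈ A, 0 < a)
    (hAroot : ∀ a ∈ A, (pencil d S).det.IsRoot a) (hdeg : (pencil d S).det.natDegree = 26 + 5)
    (hE : 1 ≤ |(pencil d S).det.coeff 0 * (pencil d S).det.leadingCoeff|) : False :=
  Theorems.LacunarySymmetroidMatrixDescartes.Defect.irow_8_26_5 d S hS A hA hApos hAroot hdeg hE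

theorem irow_8_26_6 (d : Fin 8 → ℕ) (S : Fin 8 → Matrix (Fin 2) (Fin 2) ℝ) (hS : ∀ l i j, |S l i j| ≤ 1)
    (A : Finset ℝ) (hA : A.card = 26) (hApos : ∀ a ∈ A, 0 < a)
    (hAroot : ∀ a ∈ A, (pencil d S).det.IsRoot a) (hdeg : (pencil d S).det.natDegree = 26 + 6)
    (hE : 1 ≤ |(pencil d S).det.coeff 0 * (pencil d S).det.leadingCoeff|) : False :=
  Theorems.LacunarySymmetroidMatrixDescartes.Defect.irow_8_26_6 d S hS A hA hApos hAroot hdeg hE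

/-! ### Interpolation rows, `(2,9)` with 32 positive roots: `D=3 ⇒ ≥ 138 · 4 ⇒ ≥ 51 · 5 ⇒ ≥ 21 · 6 ⇒ ≥ 9 · 7 ⇒ ≥ 4 · 8 ⇒ ≥ 2`. -/

theorem irow_9_32_3 (d : Fin 9 → ℕ) (S : Fin 9 → Matrix (Fin 2) (Fin 2) ℝ) (hS : ∀ l i j, |S l i j| ≤ 137)
    (A : Finset ℝ) (hA : A.card = 32) (hApos : ∀ a ∈ A, 0 < a)
    (hAroot : ∀ a ∈ A, (pencil d S).det.IsRoot a) (hdeg : (pencil d S).det.natDegree = 32 + 3)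
    (hE : 1 ≤ |(pencil d S).det.coeff 0 * (pencil d S).det.leadingCoeff|) : False :=
  Theorems.LacunarySymmetroidMatrixDescartes.Defect.irow_9_32_3 d S hS A hA hApos hAroot hdeg hE

theorem irow_9_32_4 (d : Fin 9 → ℕ) (S : Fin 9 → Matrix (Fin 2) (Fin 2) ℝ) (hS : ∀ l i j, |S l i j| ≤ 50)
    (A : Finset ℝ) (hA : A.card = 32) (hApos : ∀ a ∈ A, 0 < a)
    (hAroot : ∀ a ∈ A, (pencil d S).det.IsRoot a) (hdeg : (pencil d S).det.natDegree = 32 + 4)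
    (hE : 1 ≤ |(pencil d S).det.coeff 0 * (pencil d S).det.leadingCoeff|) : False :=
  Theorems.LacunarySymmetroidMatrixDescartes.Defect.irow_9_32_4 d S hS A hA hApos hAroot hdeg hE

theorem irow_9_32_5 (d : Fin 9 → ℕ) (S : Fin 9 → Matrix (Fin 2) (Fin 2) ℝ) (hS : ∀ l i j, |S l i j| ≤ 20)
    (A : Finset ℝ) (hA : A.card = 32) (hApos : ∀ a ∈ A, 0 < a)
    (hAroot : ∀ a ∈ A, (pencil d S).det.IsRoot a) (hdeg : (pencil d S).det.natDegree = 32 + 5)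
    (hE : 1 ≤ |(pencil d S).det.coeff 0 * (pencil d S).det.leadingCoeff|) : False :=
  Theorems.LacunarySymmetroidMatrixDescartes.Defect.irow_9_32_5 d S hS A hA hApos hAroot hdeg hE

theorem irow_9_32_6 (d : Fin 9 → ℕ) (S : Fin 9 → Matrix (Fin 2) (Fin 2) ℝ) (hS : ∀ l i j, |S l i j| ≤ 8)
    (A : Finset ℝ) (hA : A.card = 32) (hApos : ∀ a ∈ A, 0 < a)
    (hAroot : ∀ a ∈ A, (pencil d S).det.IsRoot a) (hdeg : (pencil d S).det.natDegree = 32 + 6)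
    (hE : 1 ≤ |(pencil d S).det.coeff 0 * (pencil d S).det.leadingCoeff|) : False :=
  Theorems.LacunarySymmetroidMatrixDescartes.Defect.irow_9_32_6 d S hS A hA hApos hAroot hdeg hE

theorem irow_9_32_7 (d : Fin 9 → ℕ) (S : Fin 9 → Matrix (Fin 2) (Fin 2) ℝ) (hS : ∀ l i j, |S l i j| ≤ 3)
    (A : Finset ℝ) (hA : A.card = 32) (hApos : ∀ a ∈ A, 0 < a)
    (hAroot : ∀ a ∈ A, (pencil d S).det.IsRoot a) (hdeg : (pencil d S).det.natDegree = 32 + 7)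
    (hE : 1 ≤ |(pencil d S).det.coeff 0 * (pencil d S).det.leadingCoeff|) : False :=
  Theorems.LacunarySymmetroidMatrixDescartes.Defect.irow_9_32_7 d S hS A hA hApos hAroot hdeg hE

theorem irow_9_32_8 (d : Fin 9 → ℕ) (S : Fin 9 → Matrix (Fin 2) (Fin 2) ℝ) (hS : ∀ l i j, |S l i j| ≤ 1)
    (A : Finset ℝ) (hA : A.card = 32) (hApos : ∀ a ∈ A, 0 < a)
    (hAroot : ∀ a ∈ A, (pencil d S).det.IsRoot a) (hdeg : (pencil d S).det.natDegree = 32 + 8)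
    (hE : 1 ≤ |(pencil d S).det.coeff 0 * (pencil d S).det.leadingCoeff|) : False :=
  Theorems.LacunarySymmetroidMatrixDescartes.Defect.irow_9_32_8 d S hS A hA hApos hAroot hdeg hE

/-! ### Interpolation rows, `(2,7)` with 20 positive roots: `D=3 ⇒ ≥ 4 · 4 ⇒ ≥ 2`. -/

theorem irow_7_20_3 (d : Fin 7 → ℕ) (S : Fin 7 → Matrix (Fin 2) (Fin 2) ℝ) (hS : ∀ l i j, |S l i j| ≤ 3)
    (A : Finset ℝ) (hA : A.card = 20) (hApos : ∀ a ∈ A, 0 < a)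
    (hAroot : ∀ a ∈ A, (pencil d S).det.IsRoot a) (hdeg : (pencil d S).det.natDegree = 20 + 3)
    (hE : 1 ≤ |(pencil d S).det.coeff 0 * (pencil d S).det.leadingCoeff|) : False :=
  Theorems.LacunarySymmetroidMatrixDescartes.Defect.irow_7_20_3 d S hS A hA hApos hAroot hdeg hE

theorem irow_7_20_4 (d : Fin 7 → ℕ) (S : Fin 7 → Matrix (Fin 2) (Fin 2) ℝ) (hS : ∀ l i j, |S l i j| ≤ 1)
    (A : Finset ℝ) (hA : A.card = 20) (hApos : ∀ a ∈ A, 0 < a)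
    (hAroot : ∀ a ∈ A, (pencil d S).det.IsRoot a) (hdeg : (pencil d S).det.natDegree = 20 + 4)
    (hE : 1 ≤ |(pencil d S).det.coeff 0 * (pencil d S).det.leadingCoeff|) : False :=
  Theorems.LacunarySymmetroidMatrixDescartes.Defect.irow_7_20_4 d S hS A hA hApos hAroot hdeg hE

/-! ## §10 Positive packaging for citation by name (crit-1 VERDICT #25 port note) -/

/- (rev 3: `NearFullHeightRow` — docstring of the v2.1 local definition, now RE-EXPORTED from `Theorems.LacunarySymmetroidMatrixDescartes.Defect`) `NearFullHeightRow K Z D H`: NO pencil `Σ_{l<K} t^{d_l} S_l` of real `2×2` letters with entries `≤ H` has a set of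
`Z` distinct positive roots of `det`, degree exactly `Z + D` and integer-normalised ends `|c₀·lc| ≥ 1`.
(Exponents `d` arbitrary; letters need not be symmetric.) -/
-- rev 3: `NearFullHeightRow` := `Theorems.LacunarySymmetroidMatrixDescartes.Defect.NearFullHeightRow` (re-exported after the namespace header; v2.1 text was:)
--   def NearFullHeightRow (K Z D : ℕ) (H : ℝ) : Prop :=
--     ∀ (d : Fin K → ℕ) (S : Fin K → Matrix (Fin 2) (Fin 2) ℝ), (∀ l i j, |S l i j| ≤ H) →
--       ∀ A : Finset ℝ, A.card = Z → (∀ a ∈ A, 0 < a) → (∀ a ∈ A, (pencil d S).det.IsRoot a) →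
--         (pencil d S).det.natDegree = Z + D →
--           1 ≤ |(pencil d S).det.coeff 0 * (pencil d S).det.leadingCoeff| → False

theorem nearFullHeightRow_mono {K Z D : ℕ} {H H' : ℝ} (hH : H' ≤ H) (h : NearFullHeightRow K Z D H) :
    NearFullHeightRow K Z D H' :=
  Theorems.LacunarySymmetroidMatrixDescartes.Defect.nearFullHeightRow_mono hH h

/-! The table (best of §6/§9 per cell): `(2,8)`, Z=26: D=1…6 ↦ H = 292, 84, 22, 8, 3, 1;
`(2,9)`, Z=32: D=1…8 ↦ 1980, 542, 137, 50, 20, 8, 3, 1; `(2,7)`, Z=20: D=1…4 ↦ 44, 13, 3, 1; `(2,6)`, Z=16: D=1,2 ↦ 13, 4.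
(`NearFullHeightRow K Z D H` = «entries ≤ H impossible», so the minimal admissible integer height is `H+1`.) -/

theorem nearFullHeightRow_6_16_1 : NearFullHeightRow 6 16 1 13 :=
  Theorems.LacunarySymmetroidMatrixDescartes.Defect.nearFullHeightRow_6_16_1

theorem nearFullHeightRow_6_16_2 : NearFullHeightRow 6 16 2 4 :=
  Theorems.LacunarySymmetroidMatrixDescartes.Defect.nearFullHeightRow_6_16_2

theorem nearFullHeightRow_7_20_1 : NearFullHeightRow 7 20 1 44 :=
  Theorems.LacunarySymmetroidMatrixDescartes.Defect.nearFullHeightRow_7_20_1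

theorem nearFullHeightRow_7_20_2 : NearFullHeightRow 7 20 2 13 :=
  Theorems.LacunarySymmetroidMatrixDescartes.Defect.nearFullHeightRow_7_20_2

theorem nearFullHeightRow_7_20_3 : NearFullHeightRow 7 20 3 3 :=
  Theorems.LacunarySymmetroidMatrixDescartes.Defect.nearFullHeightRow_7_20_3

theorem nearFullHeightRow_7_20_4 : NearFullHeightRow 7 20 4 1 :=
  Theorems.LacunarySymmetroidMatrixDescartes.Defect.nearFullHeightRow_7_20_4

theorem nearFullHeightRow_8_26_1 : NearFullHeightRow 8 26 1 292 :=
  Theorems.LacunarySymmetroidMatrixDescartes.Defect.nearFullHeightRow_8_26_1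

theorem nearFullHeightRow_8_26_2 : NearFullHeightRow 8 26 2 84 :=
  Theorems.LacunarySymmetroidMatrixDescartes.Defect.nearFullHeightRow_8_26_2

theorem nearFullHeightRow_8_26_3 : NearFullHeightRow 8 26 3 22 :=
  Theorems.LacunarySymmetroidMatrixDescartes.Defect.nearFullHeightRow_8_26_3

theorem nearFullHeightRow_8_26_4 : NearFullHeightRow 8 26 4 8 :=
  Theorems.LacunarySymmetroidMatrixDescartes.Defect.nearFullHeightRow_8_26_4

theorem nearFullHeightRow_8_26_5 : NearFullHeightRow 8 26 5 3 :=
  Theorems.LacunarySymmetroidMatrixDescartes.Defect.nearFullHeightRow_8_26_5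

theorem nearFullHeightRow_8_26_6 : NearFullHeightRow 8 26 6 1 :=
  Theorems.LacunarySymmetroidMatrixDescartes.Defect.nearFullHeightRow_8_26_6

theorem nearFullHeightRow_9_32_1 : NearFullHeightRow 9 32 1 1980 :=
  Theorems.LacunarySymmetroidMatrixDescartes.Defect.nearFullHeightRow_9_32_1

theorem nearFullHeightRow_9_32_2 : NearFullHeightRow 9 32 2 542 :=
  Theorems.LacunarySymmetroidMatrixDescartes.Defect.nearFullHeightRow_9_32_2

theorem nearFullHeightRow_9_32_3 : NearFullHeightRow 9 32 3 137 :=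
  Theorems.LacunarySymmetroidMatrixDescartes.Defect.nearFullHeightRow_9_32_3

theorem nearFullHeightRow_9_32_4 : NearFullHeightRow 9 32 4 50 :=
  Theorems.LacunarySymmetroidMatrixDescartes.Defect.nearFullHeightRow_9_32_4

theorem nearFullHeightRow_9_32_5 : NearFullHeightRow 9 32 5 20 :=
  Theorems.LacunarySymmetroidMatrixDescartes.Defect.nearFullHeightRow_9_32_5

theorem nearFullHeightRow_9_32_6 : NearFullHeightRow 9 32 6 8 :=
  Theorems.LacunarySymmetroidMatrixDescartes.Defect.nearFullHeightRow_9_32_6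

theorem nearFullHeightRow_9_32_7 : NearFullHeightRow 9 32 7 3 :=
  Theorems.LacunarySymmetroidMatrixDescartes.Defect.nearFullHeightRow_9_32_7

theorem nearFullHeightRow_9_32_8 : NearFullHeightRow 9 32 8 1 :=
  Theorems.LacunarySymmetroidMatrixDescartes.Defect.nearFullHeightRow_9_32_8

end Summit.ValiantsHypothesis.ValiantsHypothesis.Theses.LacunarySymmetroid.DefectLine
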